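/-
Cell pub-hodgecm2 (COR-CM = stage 2 of the Hodge ladder), seat p2 (binder prover 2/8), gen 22
(prover-pub-hodgecm2-p2-g22-0), 2026-08-21.  Count-neutral own lane PERL-WEIL-LINE (work item W-a of
`hodge-director/B01-SIZE.md` §4 T2), file 3/3: the consumer of `PerL` on the model universe of record, read on real
carriers.  Theorems only; `PerL` is CONSUMED BY NAME (`Universe.PerL`, `CorCM/Geometry/Statements.lean`), never restated.
HONEST FRAMING: HC_CM is NOT proved.  What IS proved: IF the stage-1 statement `PerL` holds on the model universe of
record THEN one explicit family of `(2,2)` Weil classes on 12-dimensional CM abelian varieties is algebraic.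
-/
import Summits.HodgeConjecture.CorCM.SurfaceCriterionQuadruple
import Summits.HodgeConjecture.CorCM.Model.WeilLineClassesOfWeilLineAlg
import Summits.HodgeConjecture.CorCM.Model.ModelAxiomsHolds
import Summits.HodgeConjecture.CorCM.Model.CMAbelianVarietyRealisedHolds
import Summits.HodgeConjecture.CorCM.Geometry.BallQuotientUniformisedHolds
import Literature.AlgebraicGeometry.HodgeTheory.ComplexConjugationHolds
import Literature.AlgebraicGeometry.HodgeTheory.HodgeFiltrationModelsReductionProofs
import HarnessLib

/-!
# What `PerL` certifies on the model universe of record: the `K`-Weil-line classes of the PerL corner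
# product are algebraic (real carriers)

For the model universe `U = Model.universeOf hHD hI hU h₃` (all 28 model facts are tree theorems:
`Model.modelAxioms_holds`) the abstract arrows of `CorCM/SurfaceCriterionQuadruple.lean` and the converse junction of
`Model/WeilLineClassesOfWeilLineAlg.lean` compose to statements about the tree's real carriers
(`AbelianVariety ℂ`, `complexBetti`, `HodgeTheory.algebraicClasses`, `HodgeTheory.weilLineClasses`):

* `Model.weilLineClasses_le_algebraicClasses_of_period` — ANY CM field `K`, period quadruple `Ψ`, eigencharacter
  `σ`, surface of the model with morphisms to the `A_{(K,Ψᵢ)}` and `σ`-eigen holomorphic one-forms of non-zero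
  quadrilinear period ⟹ every `K`-Weil-line class of the corner realisations
  `A_{(K,Ψ₀)}, A_{(K,Ψ̄₂)}, A_{(K,Ψ̄₃)}, A_{(K,Ψ₁)}` (`Model.cornerAV h₃ K ![Ψ 0, bar (Ψ 2), bar (Ψ 3), Ψ 1]`) is
  algebraic on `⨁_j A_j`; `…_of_periodNV`, `…_of_exists_periodNV` (Picard modular surface over ANY CM field `L`).
* **`Model.weilLineClasses_le_algebraicClasses_of_perL`** — `U.PerL` ⟹ for every sextic CM field `K` with normal
  closure `L` of degree `24` or `48`, frame `φ`, `ι₁` over `φ 0` and PerL quadruple `t`: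
  `weilLineClasses (cornerAV h₃ K ![t 0, bar (t 2), bar (t 3), t 1]) (cornerAct …) 4 ≤ algebraicClasses (⨁ …).X 2`;
  `Model.monomial_mem_algebraicClasses_of_perL` — equivalently (p2-g10 `WeilLineMonomial.weilLineClasses_eq_iSup_span_monomial`)
  each of the `[K:ℚ] = 6` weight MONOMIALS `μ_s = π₀^*v₀(s) ∪ π₁^*v₁(s) ∪ π₂^*v₂(s) ∪ π₃^*v₃(s)` (one per complex
  embedding `s` of `K`; the «face 4-set» classes `{(0,s),(1,s̄),(2,s̄),(3,s̄)}` of the Pohlmann census when the two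
  middle factors are re-read over their own types) is an algebraic class.
* `…_rec` forms: the same on the model universe OF RECORD
  `Model.picardCMUniverse exists_isReal_hodgeModel_holds hodgePQ_independent_of_hodgeModel_holds
  BallQuotient.ballQuotientUniformised_holds cmAbelianVarietyRealised_holds` — hypothesis `U_rec.PerL` ONLY.

This is the kernel form of `hodge-director/B01-SIZE.md` §4 T2 (stage-2 lead): «with W-a, PerL certifies the named
Weil-line statement».  The upgrade «⟹ HC for every abelian variety isogenous to a product of powers of the four
threefolds» is work item W-b (seat b25, `CorCM/Census/PairFlipSexticFourCore*`: the Hodge ring of all such products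
is generated by divisors and these classes); this file is the socket it plugs into.  Nothing here uses or implies
`PerLFace`, B01 or HC_CM.
-/

noncomputable section

open CategoryTheory CategoryTheory.Limits
open Literature.AlgebraicGeometry.Motives Literature.AlgebraicGeometry.HodgeTheory
open Literature.AlgebraicGeometry.ComplexMultiplication Literature.NumberTheory.Automorphic
open Literature.NumberTheory.Automorphic.PicardCM (BallQuotientUniformisedDatum CMAbelianVarietyRealised eigenline)
open Literature.NumberTheory.ComplexMultiplication.CMTypeOps (bar)

namespace Summit.HodgeConjecture.CorCM.Model

/-! ## §1 On any instance of the model universe -/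

section General

variable (hHD : exists_isReal_hodgeModel) (hI : hodgePQ_independent_of_hodgeModel)
  (hU : BallQuotientUniformisedDatum) (h₃ : CMAbelianVarietyRealised)

/-- **Period ⟹ algebraic Weil-line classes, real carriers.**  On the model universe, a surface `S` with morphisms
`Fᵢ : S → A_{(K,Ψᵢ)}` and holomorphic `σ`-eigen one-forms of non-zero quadrilinear period makes every `K`-Weil-line
class of the corner realisations `A_{Ψ₀}, A_{Ψ̄₂}, A_{Ψ̄₃}, A_{Ψ₁}` algebraic on `⨁_j A_j` — for ANY CM field `K`,
quadruple `Ψ` and `σ` (`Universe.weilLine_quad_le_alg_of_period` over `Model.modelAxioms_holds`, then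
`Model.weilLineClasses_le_algebraicClasses_of_weilLine_le_alg`). [cite: Milne2020HodgeClassesAV, Theorem 1 (proof)] -/
theorem weilLineClasses_le_algebraicClasses_of_period (K : CMField) (Ψ : Fin 4 → CMType K) (σ : K →+* ℂ)
    (S : (universeOf hHD hI hU h₃).Var) (hS : (universeOf hHD hI hU h₃).dim S = 2)
    (Fm : (i : Fin 4) → (universeOf hHD hI hU h₃).Mor S ((universeOf hHD hI hU h₃).cmAV K (Ψ i)))
    (α : (i : Fin 4) → (universeOf hHD hI hU h₃).CohC ((universeOf hHD hI hU h₃).cmAV K (Ψ i)) 1)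
    (hα : ∀ i, α i ∈ (universeOf hHD hI hU h₃).alphaLine K (Ψ i) σ)
    (hper : (universeOf hHD hI hU h₃).period S (fun i => (universeOf hHD hI hU h₃).pullC (Fm i) 1 (α i)) ≠ 0) :
    weilLineClasses (cornerAV h₃ K ![Ψ 0, bar (Ψ 2), bar (Ψ 3), Ψ 1])
        (cornerAct h₃ K ![Ψ 0, bar (Ψ 2), bar (Ψ 3), Ψ 1]) 4 ≤
      algebraicClasses (⨁ cornerAV h₃ K ![Ψ 0, bar (Ψ 2), bar (Ψ 3), Ψ 1]).X 2 :=
  weilLineClasses_le_algebraicClasses_of_weilLine_le_alg hHD hI hU h₃ K _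
    ((universeOf hHD hI hU h₃).weilLine_quad_le_alg_of_period (modelAxioms_holds hHD hI hU h₃) K Ψ σ S hS Fm α
      hα hper)

/-- The same from a non-vanishing Picard-modular period `U.PeriodNV ι₁ V K Ψ σ` (surface `P_Γ` over ANY CM field `L`,
targets with CM by `K`). [cite: Milne2020HodgeClassesAV, Theorem 1 (proof)] -/
theorem weilLineClasses_le_algebraicClasses_of_periodNV {L : CMField} {ι₁ : L →+* ℂ} {V : HermSpace3 L ι₁}
    {K : CMField} {Ψ : Fin 4 → CMType K} {σ : K →+* ℂ}
    (h : (universeOf hHD hI hU h₃).PeriodNV ι₁ V K Ψ σ) :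
    weilLineClasses (cornerAV h₃ K ![Ψ 0, bar (Ψ 2), bar (Ψ 3), Ψ 1])
        (cornerAct h₃ K ![Ψ 0, bar (Ψ 2), bar (Ψ 3), Ψ 1]) 4 ≤
      algebraicClasses (⨁ cornerAV h₃ K ![Ψ 0, bar (Ψ 2), bar (Ψ 3), Ψ 1]).X 2 :=
  weilLineClasses_le_algebraicClasses_of_weilLine_le_alg hHD hI hU h₃ K _
    ((universeOf hHD hI hU h₃).weilLine_quad_le_alg_of_periodNV (modelAxioms_holds hHD hI hU h₃) h)

/-- The same from the EXISTENCE of some Picard-modular period datum for `(K, Ψ)` — the per-configuration arrow of the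
degree-by-degree existence lane, real-carrier form. [cite: Milne2020HodgeClassesAV, Theorem 1 (proof)] -/
theorem weilLineClasses_le_algebraicClasses_of_exists_periodNV {K : CMField} {Ψ : Fin 4 → CMType K}
    (h : ∃ (L : CMField) (ι₁ : L →+* ℂ) (V : HermSpace3 L ι₁) (σ : K →+* ℂ),
      (universeOf hHD hI hU h₃).PeriodNV ι₁ V K Ψ σ) :
    weilLineClasses (cornerAV h₃ K ![Ψ 0, bar (Ψ 2), bar (Ψ 3), Ψ 1])
        (cornerAct h₃ K ![Ψ 0, bar (Ψ 2), bar (Ψ 3), Ψ 1]) 4 ≤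
      algebraicClasses (⨁ cornerAV h₃ K ![Ψ 0, bar (Ψ 2), bar (Ψ 3), Ψ 1]).X 2 := by
  obtain ⟨L, ι₁, V, σ, h⟩ := h
  exact weilLineClasses_le_algebraicClasses_of_periodNV hHD hI hU h₃ h

/-- **`PerL` ⟹ the `K`-Weil-line classes of the PerL corner product are algebraic (real carriers).**  If the stage-1
statement `PerL` holds on the model universe `U = Model.universeOf hHD hI hU h₃`, then for every sextic CM field `K`,
normal closure `j : K → L` with `[L:ℚ] ∈ {24, 48}`, frame `φ`, `ι₁ : L → ℂ` over `φ 0` and PerL quadruple `t`, every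
class of `weilLineClasses (A_{(K,t⁰)}, A_{(K,t̄²)}, A_{(K,t̄³)}, A_{(K,t¹)}) 4 ⊂ H⁴((⨁_j A_j)(ℂ); ℂ)` is algebraic
(`Universe.weilLine_le_alg_of_perL` + the converse junction).  This is what PerL certifies Hodge-theoretically
(`hodge-director/B01-SIZE.md` §4 T2, W-a); NOT HC_CM. [cite: Milne2020HodgeClassesAV, Theorem 1 (proof)] -/
theorem weilLineClasses_le_algebraicClasses_of_perL (hP : (universeOf hHD hI hU h₃).PerL)
    (K L : CMField) (j : K →+* L) (hN : IsNormalClosure ℚ K L) (h6 : Module.finrank ℚ K = 6)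
    (hL : Module.finrank ℚ L = 24 ∨ Module.finrank ℚ L = 48)
    (φ : Fin 3 → (K →+* ℂ)) (hφ : IsFrame φ) (ι₁ : L →+* ℂ) (hι : ι₁.comp j = φ 0)
    (t : Fin 4 → CMType K) (ht : IsPerLTypes φ t) :
    weilLineClasses (cornerAV h₃ K ![t 0, bar (t 2), bar (t 3), t 1])
        (cornerAct h₃ K ![t 0, bar (t 2), bar (t 3), t 1]) 4 ≤
      algebraicClasses (⨁ cornerAV h₃ K ![t 0, bar (t 2), bar (t 3), t 1]).X 2 :=
  weilLineClasses_le_algebraicClasses_of_weilLine_le_alg hHD hI hU h₃ K _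
    ((universeOf hHD hI hU h₃).weilLine_le_alg_of_perL (modelAxioms_holds hHD hI hU h₃) hP K L j hN h6 hL φ hφ ι₁
      hι t ht)

/-- **`PerL` ⟹ the six weight monomials of the PerL corner product are algebraic.**  With eigenbases `v_j` of
`H¹(A_j(ℂ); ℂ)` (`v_j(s)` in the `s`-eigenline of the `K`-action; they exist: `AndreProductForm.exists_eigenbasis`),
each monomial `μ_s = π₀^*v₀(s) ∪ π₁^*v₁(s) ∪ π₂^*v₂(s) ∪ π₃^*v₃(s)` (`s : K →+* ℂ`; the classes spanning the
`K`-Weil-line space, p2-g10 `WeilLineMonomial.weilLineClasses_eq_iSup_span_monomial`) of the corner family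
`A_{t⁰}, A_{t̄²}, A_{t̄³}, A_{t¹}` is an algebraic class on `⨁_j A_j`. [cite: Milne2020HodgeClassesAV, §2.1–2.2] -/
theorem monomial_mem_algebraicClasses_of_perL (hP : (universeOf hHD hI hU h₃).PerL)
    (K L : CMField) (j : K →+* L) (hN : IsNormalClosure ℚ K L) (h6 : Module.finrank ℚ K = 6)
    (hL : Module.finrank ℚ L = 24 ∨ Module.finrank ℚ L = 48)
    (φ : Fin 3 → (K →+* ℂ)) (hφ : IsFrame φ) (ι₁ : L →+* ℂ) (hι : ι₁.comp j = φ 0)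
    (t : Fin 4 → CMType K) (ht : IsPerLTypes φ t)
    (v : ∀ i : Fin 4, Module.Basis (K →+* ℂ) ℂ (complexBetti (cornerAV h₃ K ![t 0, bar (t 2), bar (t 3), t 1] i).X 1))
    (hv : ∀ i σ, v i σ ∈ eigenline (cornerTheta h₃ K ![t 0, bar (t 2), bar (t 3), t 1] i) σ) (s : K →+* ℂ) :
    WeilLineMonomial.monomial (cornerAV h₃ K ![t 0, bar (t 2), bar (t 3), t 1]) v s ∈
      algebraicClasses (⨁ cornerAV h₃ K ![t 0, bar (t 2), bar (t 3), t 1]).X 2 :=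
  weilLineClasses_le_algebraicClasses_of_perL hHD hI hU h₃ hP K L j hN h6 hL φ hφ ι₁ hι t ht
    (WeilLineMonomial.monomial_mem_weilLineClasses
      (fun i => cornerAV_isCMTypeRealisation h₃ K ![t 0, bar (t 2), bar (t 3), t 1] i) hv s)

end General

/-! ## §2 On the model universe OF RECORD (all four data are tree theorems; hypothesis `PerL` only) -/

section Record

/-- **`PerL(U_rec)` ⟹ algebraic Weil-line classes of every PerL corner product** — the model universe of record
`U_rec = Model.picardCMUniverse exists_isReal_hodgeModel_holds hodgePQ_independent_of_hodgeModel_holds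
BallQuotient.ballQuotientUniformised_holds cmAbelianVarietyRealised_holds` (the universe of the cell's E-term display
`hc_cm_closed_of_perLFace`); single hypothesis `U_rec.PerL` = stage 1's E-term statement.  For every sextic CM field
`K` of the stage-1 class, frame, `ι₁` and PerL quadruple `t`: the `K`-Weil-line classes of
`A_{(K,t⁰)} ⊕ A_{(K,t̄²)} ⊕ A_{(K,t̄³)} ⊕ A_{(K,t¹)}` (the cell's chosen realisations `cmRealisation … (cmCode K _)`)
are algebraic.  NOT HC_CM; not a case of `PerLFace`. [cite: Milne2020HodgeClassesAV, Theorem 1 (proof)] -/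
theorem weilLineClasses_le_algebraicClasses_of_perL_rec
    (hP : (picardCMUniverse exists_isReal_hodgeModel_holds hodgePQ_independent_of_hodgeModel_holds
      BallQuotient.ballQuotientUniformised_holds cmAbelianVarietyRealised_holds).PerL)
    (K L : CMField) (j : K →+* L) (hN : IsNormalClosure ℚ K L) (h6 : Module.finrank ℚ K = 6)
    (hL : Module.finrank ℚ L = 24 ∨ Module.finrank ℚ L = 48)
    (φ : Fin 3 → (K →+* ℂ)) (hφ : IsFrame φ) (ι₁ : L →+* ℂ) (hι : ι₁.comp j = φ 0)
    (t : Fin 4 → CMType K) (ht : IsPerLTypes φ t) :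
    weilLineClasses (cornerAV cmAbelianVarietyRealised_holds K ![t 0, bar (t 2), bar (t 3), t 1])
        (cornerAct cmAbelianVarietyRealised_holds K ![t 0, bar (t 2), bar (t 3), t 1]) 4 ≤
      algebraicClasses (⨁ cornerAV cmAbelianVarietyRealised_holds K ![t 0, bar (t 2), bar (t 3), t 1]).X 2 :=
  weilLineClasses_le_algebraicClasses_of_perL exists_isReal_hodgeModel_holds hodgePQ_independent_of_hodgeModel_holds
    (PicardCM.ballQuotientUniformisedDatum_of BallQuotient.ballQuotientUniformised_holds) cmAbelianVarietyRealised_holds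
    hP K L j hN h6 hL φ hφ ι₁ hι t ht

/-- On the model universe of record: a non-vanishing Picard-modular period for ANY `(K, Ψ, σ)` over ANY surface field
`L` makes the `K`-Weil-line classes of `A_{Ψ₀} ⊕ A_{Ψ̄₂} ⊕ A_{Ψ̄₃} ⊕ A_{Ψ₁}` algebraic — the per-configuration arrow
for the existence lane (no Galois / face / admissibility hypothesis). [cite: Milne2020HodgeClassesAV, Theorem 1 (proof)] -/
theorem weilLineClasses_le_algebraicClasses_of_periodNV_rec {L : CMField} {ι₁ : L →+* ℂ} {V : HermSpace3 L ι₁}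
    {K : CMField} {Ψ : Fin 4 → CMType K} {σ : K →+* ℂ}
    (h : (picardCMUniverse exists_isReal_hodgeModel_holds hodgePQ_independent_of_hodgeModel_holds
      BallQuotient.ballQuotientUniformised_holds cmAbelianVarietyRealised_holds).PeriodNV ι₁ V K Ψ σ) :
    weilLineClasses (cornerAV cmAbelianVarietyRealised_holds K ![Ψ 0, bar (Ψ 2), bar (Ψ 3), Ψ 1])
        (cornerAct cmAbelianVarietyRealised_holds K ![Ψ 0, bar (Ψ 2), bar (Ψ 3), Ψ 1]) 4 ≤
      algebraicClasses (⨁ cornerAV cmAbelianVarietyRealised_holds K ![Ψ 0, bar (Ψ 2), bar (Ψ 3), Ψ 1]).X 2 :=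
  weilLineClasses_le_algebraicClasses_of_periodNV exists_isReal_hodgeModel_holds
    hodgePQ_independent_of_hodgeModel_holds
    (PicardCM.ballQuotientUniformisedDatum_of BallQuotient.ballQuotientUniformised_holds) cmAbelianVarietyRealised_holds h

end Record

end Summit.HodgeConjecture.CorCM.Model

end
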